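import Literature.NumberTheory.LocalFields.EquivariantUnitRigidityNormed
import Mathlib.NumberTheory.LocalField.Basic
import Mathlib.RingTheory.Henselian
import Mathlib.RingTheory.LocalRing.ResidueField.Basic
import Mathlib.FieldTheory.Perfect
import HarnessLib

/-!
# The valuation ring `𝒪_K = {‖x‖ ≤ 1}` of a finite extension `K` of `ℚ_p` in NORM currency:
# Henselian, with finite (hence perfect) residue field of characteristic `p`

Proof file (theorems only, no definitions, no instances declared, no named facts, no `sorry`) in
topic `NumberTheory/LocalFields`.  The tree's `K`-port of the elliptic-curve reduction theory
(cell `bsd-addord`, crux `KatoKuriharaPortThreeShared`, clause (C1.c)) is written for an abstract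
non-trivially normed ultrametric field `K` which is a normed `ℚ_p`-algebra, finite-dimensional
over `ℚ_p`, with valuation ring the closed unit ball `(NormedField.valuation (K := K)).integer`.
The classical structure facts about this ring (Serre, *Local Fields*, Ch. II §1 Prop. 1 and §4
Prop. 7; Neukirch, *ANT*, Ch. II (4.6) Hensel's lemma and (5.1)) are in Mathlib for the
ValuativeRel currency `𝒪[K]` of `IsNonarchimedeanLocalField K` (`IsAdicComplete 𝓂[K] 𝒪[K]`,
`IsDiscreteValuationRing 𝒪[K]`, `Finite 𝓀[K]`), and the tree's
`isNonarchimedeanLocalField_of_normedField` (`EquivariantUnitRigidityNormed`) puts a locally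
compact normed `K` into that currency.  This file carries them over to the norm currency:

* `integer_valuation_ofValuation_eq` — the two valuation rings are the SAME subring of `K`
  (`ValuativeRel.valuation K` and `NormedField.valuation` are equivalent valuations);
* `henselianLocalRing_integer`, `henselianRing_maximalIdeal_integer` — **Hensel's lemma** for
  `{‖x‖ ≤ 1}` (a simple root modulo `𝔪` of a monic polynomial lifts), transported along the ring
  isomorphism of equal subrings (`henselianLocalRing_of_ringEquiv`);
* `finite_residueField_integer` — finite residue field;
* `charP_residueField_integer`, `perfectRing_residueField_integer` — for a normed `ℚ_p`-algebra
  `K`, the residue field has characteristic `p` (`‖p‖ < 1`) and, being finite, is perfect;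
* `_of_finiteDimensional_padic` corollaries — every normed `ℚ_p`-algebra field that is
  finite-dimensional over `ℚ_p` is locally compact (Mathlib `FiniteDimensional.proper`).

Use: input (r4) "`𝒪_K` henselian" (so the reduction map `E₀(K) → Ẽ_ns(k)` is onto, tree
`WeierstrassCurve.reductionHom_surjective`) and "`k` perfect of characteristic `p`" (so a
cuspidal reduction has a `k`-rational chart, tree `SingularCubicCuspCharThreeProofs`) of the
residue-field statement `∃ P ∈ E₀(K), N(P) ∉ E₁(K)`.

## References

* [SerreLocalFields1979] J.-P. Serre, *Local Fields*, GTM 67 (1979), Ch. II §1 Prop. 1 (locally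
  compact ⇔ complete, discrete, finite residue field), §4 Prop. 7 (Hensel's lemma).
* [NeukirchANT1999] J. Neukirch, *Algebraic Number Theory* (1999), Ch. II (4.6) (Hensel's lemma),
  (5.1)–(5.2) (local fields).

## Design

No definitions or instances; the ValuativeRel structure `ValuativeRel.ofValuation
NormedField.valuation` is introduced by `letI` inside proofs only, never in statements (all
statements are about `(NormedField.valuation (K := K)).integer`).  Consumers introduce the
results with `haveI`.
-/

noncomputable section

open scoped NNReal

namespace Literature.NumberTheory.LocalFields

open ValuativeRel IsLocalRing Polynomial

universe u

/-! ## §1 Transport of the Henselian property along a ring isomorphism -/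

section Transport

/-- Hensel's property is invariant under ring isomorphisms (bookkeeping). [folklore] -/
private theorem henselianLocalRing_of_ringEquiv {R S : Type*} [CommRing R] [CommRing S]
    [HenselianLocalRing R] [IsLocalRing S] (e : R ≃+* S) : HenselianLocalRing S where
  is_henselian f hf a₀ h₁ h₂ := by
    have hunit : ∀ s : S, IsUnit (e.symm s) ↔ IsUnit s := fun s => isUnit_map_iff e.symm s
    -- transport the data to `R`
    set g : R[X] := f.map (e.symm : S →+* R) with hg
    have hgm : g.Monic := hf.map _
    have hev : ∀ b : R, g.eval b = e.symm (f.eval (e b)) := fun b => by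
      have h := eval₂_hom (e.symm : S →+* R) (e b) (p := f)
      rw [hg, eval_map]
      rwa [RingHom.coe_coe, e.symm_apply_apply] at h
    have hev' : ∀ b : R, g.derivative.eval b = e.symm (f.derivative.eval (e b)) := fun b => by
      have h := eval₂_hom (e.symm : S →+* R) (e b) (p := derivative f)
      rw [hg, derivative_map, eval_map]
      rwa [RingHom.coe_coe, e.symm_apply_apply] at h
    have h₁' : g.eval (e.symm a₀) ∈ maximalIdeal R := by
      rw [hev, e.apply_symm_apply, mem_maximalIdeal, mem_nonunits_iff, hunit]
      rwa [mem_maximalIdeal, mem_nonunits_iff] at h₁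
    have h₂' : IsUnit (g.derivative.eval (e.symm a₀)) := by
      rw [hev', e.apply_symm_apply, hunit]
      exact h₂
    obtain ⟨b, hb, hb₀⟩ := HenselianLocalRing.is_henselian g hgm (e.symm a₀) h₁' h₂'
    refine ⟨e b, ?_, ?_⟩
    · have h0 : e.symm (f.eval (e b)) = 0 := (hev b).symm.trans hb
      exact (map_eq_zero_iff e.symm e.symm.injective).mp h0
    · have hmem : e.symm (e b - a₀) ∈ maximalIdeal R := by
        rwa [map_sub, e.symm_apply_apply]
      rw [mem_maximalIdeal, mem_nonunits_iff, hunit] at hmem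
      rwa [mem_maximalIdeal, mem_nonunits_iff]

end Transport

/-! ## §2 The unit ball of a locally compact ultrametric normed field -/

section Normed

variable (K : Type u) [NontriviallyNormedField K] [IsUltrametricDist K]

/-- The valuation ring of the valuative relation of the norm IS the closed unit ball
`(NormedField.valuation).integer` (the two valuations are equivalent).
[cite: SerreLocalFields1979, Ch. II §1] -/
theorem integer_valuation_ofValuation_eq :
    (@ValuativeRel.valuation K _ (ValuativeRel.ofValuation (NormedField.valuation (K := K)))).integer
      = (NormedField.valuation (K := K)).integer := by
  letI : ValuativeRel K := ValuativeRel.ofValuation (NormedField.valuation (K := K))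
  haveI : (NormedField.valuation (K := K)).Compatible := .ofValuation _
  ext x
  rw [Valuation.mem_integer_iff, Valuation.mem_integer_iff]
  exact (ValuativeRel.isEquiv (valuation K) (NormedField.valuation (K := K))).le_one_iff_le_one

variable [LocallyCompactSpace K]

/-- **Hensel's lemma for the unit ball of a locally compact ultrametric normed field**: the
valuation ring `{‖x‖ ≤ 1}` is a Henselian local ring (Mathlib: a non-archimedean local field has
`𝒪[K]` adically complete, hence Henselian; transported to the norm currency).
[cite: SerreLocalFields1979, Ch. II §4 Prop. 7] [cite: NeukirchANT1999, Ch. II (4.6)] -/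
theorem henselianLocalRing_integer :
    HenselianLocalRing (NormedField.valuation (K := K)).integer := by
  letI : ValuativeRel K := ValuativeRel.ofValuation (NormedField.valuation (K := K))
  haveI : IsNonarchimedeanLocalField K := isNonarchimedeanLocalField_of_normedField K
  haveI : HenselianLocalRing 𝒪[K] :=
    { is_henselian := fun f hf a₀ h₁ h₂ =>
        HenselianRing.is_henselian (I := 𝓂[K]) f hf a₀ h₁ (h₂.map (Ideal.Quotient.mk _)) }
  exact henselianLocalRing_of_ringEquiv (RingEquiv.subringCongr (integer_valuation_ofValuation_eq K))

/-- Hensel's lemma in the `HenselianRing R (maximalIdeal R)` form consumed by the tree's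
`WeierstrassCurve.reductionHom_surjective`. [cite: SerreLocalFields1979, Ch. II §4 Prop. 7] -/
theorem henselianRing_maximalIdeal_integer :
    HenselianRing (NormedField.valuation (K := K)).integer
      (maximalIdeal (NormedField.valuation (K := K)).integer) := by
  haveI := henselianLocalRing_integer K
  infer_instance

/-- **The residue field of the unit ball of a locally compact ultrametric normed field is
finite.** [cite: SerreLocalFields1979, Ch. II §1 Prop. 1] -/
theorem finite_residueField_integer :
    Finite (ResidueField (NormedField.valuation (K := K)).integer) := by
  letI : ValuativeRel K := ValuativeRel.ofValuation (NormedField.valuation (K := K))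
  haveI : IsNonarchimedeanLocalField K := isNonarchimedeanLocalField_of_normedField K
  exact Finite.of_equiv 𝓀[K]
    (ResidueField.mapEquiv (RingEquiv.subringCongr (integer_valuation_ofValuation_eq K))).toEquiv

end Normed

/-! ## §3 Normed `ℚ_p`-algebras finite-dimensional over `ℚ_p` -/

section Padic

variable (p : ℕ) [hp : Fact p.Prime] (K : Type u) [NontriviallyNormedField K] [NormedAlgebra ℚ_[p] K]
  [IsUltrametricDist K]

/-- **The residue field of `{‖x‖ ≤ 1}` has characteristic `p`** for a normed `ℚ_p`-algebra field
(`‖p‖ = p⁻¹ < 1`, so `p ∈ 𝔪`). [cite: SerreLocalFields1979, Ch. II §1] -/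
theorem charP_residueField_integer :
    CharP (ResidueField (NormedField.valuation (K := K)).integer) p := by
  have hpK : ‖(p : K)‖ < 1 := by
    rw [← map_natCast (algebraMap ℚ_[p] K) p, norm_algebraMap', Padic.norm_p]
    exact inv_lt_one_of_one_lt₀ (by exact_mod_cast hp.out.one_lt)
  refine (CharP.charP_iff_prime_eq_zero hp.out).mpr ?_
  rw [← map_natCast (residue (NormedField.valuation (K := K)).integer) p, residue_eq_zero_iff,
    mem_maximalIdeal, mem_nonunits_iff, Valuation.Integer.not_isUnit_iff_valuation_lt_one,
    SubringClass.coe_natCast, NormedField.valuation_apply, ← NNReal.coe_lt_coe, coe_nnnorm,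
    NNReal.coe_one]
  exact hpK

/-- **Hensel's lemma for `{‖x‖ ≤ 1}` in a finite extension of `ℚ_p`** (norm currency; every normed
`ℚ_p`-algebra field finite-dimensional over `ℚ_p` is locally compact).
[cite: SerreLocalFields1979, Ch. II §4 Prop. 7] [cite: NeukirchANT1999, Ch. II (4.6)] -/
theorem henselianLocalRing_integer_of_finiteDimensional_padic [FiniteDimensional ℚ_[p] K] : HenselianLocalRing (NormedField.valuation (K := K)).integer := by
  haveI : ProperSpace K := FiniteDimensional.proper ℚ_[p] K
  exact henselianLocalRing_integer K

/-- Hensel's lemma, `HenselianRing R (maximalIdeal R)` form, for a finite extension of `ℚ_p`.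
[cite: SerreLocalFields1979, Ch. II §4 Prop. 7] -/
theorem henselianRing_maximalIdeal_integer_of_finiteDimensional_padic [FiniteDimensional ℚ_[p] K] :
    HenselianRing (NormedField.valuation (K := K)).integer
      (maximalIdeal (NormedField.valuation (K := K)).integer) := by
  haveI : ProperSpace K := FiniteDimensional.proper ℚ_[p] K
  exact henselianRing_maximalIdeal_integer K

/-- **The residue field of a finite extension of `ℚ_p` is finite** (norm currency).
[cite: SerreLocalFields1979, Ch. II §1 Prop. 1] -/
theorem finite_residueField_integer_of_finiteDimensional_padic [FiniteDimensional ℚ_[p] K] :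
    Finite (ResidueField (NormedField.valuation (K := K)).integer) := by
  haveI : ProperSpace K := FiniteDimensional.proper ℚ_[p] K
  exact finite_residueField_integer K

/-- The residue field of a finite extension of `ℚ_p` is a PERFECT field of characteristic `p`
(finite fields are perfect). [cite: SerreLocalFields1979, Ch. II §1 Prop. 1] -/
theorem perfectRing_residueField_integer_of_finiteDimensional_padic [FiniteDimensional ℚ_[p] K] :
    PerfectRing (ResidueField (NormedField.valuation (K := K)).integer) p := by
  haveI := charP_residueField_integer p K
  haveI := finite_residueField_integer_of_finiteDimensional_padic p K
  infer_instance

end Padic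

end Literature.NumberTheory.LocalFields

end
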